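import Literature.Geometry.Kaehler.ComplexTorusHodge
import HarnessLib

/-!
# The Weil operator `J = diag(i, i, -i, -i)` on `ℂ⁴` and the Weil form `dz₀ ∧ dz₁ ∧ dz̄₂ ∧ dz̄₃`

Companion of `Literature/Geometry/Kaehler/ComplexTorusZuckerJ.lean` (S. Zucker, Compositio 34
(1977), Appendix B, for `n = 1` on `ℂ²`) and `ComplexTorusHodge.lean` (invariant forms of type
`(p, q)` on a complex torus, `ComplexTorus.IsConstOfType`). This file is the case `n = 2` of
Zucker's appendix, i.e. the linear algebra of the **complex tori of Weil type** of C. Voisin,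
*A counterexample to the Hodge conjecture extended to Kähler varieties*, IMRN 2002 no. 20, §3:
a `ℤ[I]`-action on `Γ = ℤ⁸` and a complex structure on `Γ_ℝ` for which `I` acts `ℂ`-linearly with
eigenvalues `i, i, -i, -i` (`dim W_i = dim W_{-i} = 2`, loc. cit. p. 5 of arXiv:math/0112247); in
coordinates on `V = ℂ⁴` the action of `I` is

* `Weil.J : ℂ⁴ →L[ℂ] ℂ⁴`, `J(z₀, z₁, z₂, z₃) = (iz₀, iz₁, -iz₂, -iz₃)` (`Weil.J_J : J² = -1`), and
  `Weil.S = 1 + J`, the `ℂ`-linear map underlying the isogeny `1 + I` of the torus;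
* `Weil.Omega = dz₀ ∧ dz₁ ∧ dz̄₂ ∧ dz̄₃`, a continuous alternating real `4`-form on `ℂ⁴` with complex
  values — a generator of the line `⋀⁴ (ℂ⁴_i)^* = ⋀² W_i^* ⊗ ⋀² W̄_{-i}^*` of Voisin's proof that
  `⋀⁴_K Γ_ℚ ⊂ H^{2,2}(X)` (loc. cit. pp. 5–6: "`⋀⁴ ℂ⁴_i = ⋀² W_i ⊗ ⋀² W̄_{-i}` is contained in
  `⋀² W ⊗ ⋀² W̄`, that is in `H^{2,2}(X)`"); Zucker p. 208 for general `n`: the form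
  `dz₁ ∧ ⋯ ∧ dz_n ∧ dw̄₁ ∧ ⋯ ∧ dw̄_n` with `J^* = i^{2n}`;
* `Weil.isConstOfType_two_two_Omega`: **`Ω` is of type `(2, 2)`** (`U(1)`-weight `0`), so that on
  every complex torus `X = ℂ⁴/Φ(ℤ⁸)` the invariant form `Ω` defines a class in `H^{2,2}(X)`
  (`Weil.cconstClass_Omega_mem_hodgePQ`, from `ComplexTorus.cconstClass_mem_hodgePQ`);
* `Weil.Omega_J : J^*Ω = Ω` (`i · i · \bar{(-i)} · \bar{(-i)} = i⁴ = 1`, Zucker's `i^{2n}`, `n = 2`),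
  `Weil.Omega_S : (1 + J)^*Ω = -4 Ω` (`(1+i)⁴ = -4`: `Ω` is a `-4`-eigenvector of the isogeny
  `1 + I` acting on invariant `4`-forms — the eigenvalue that singles out the Weil classes
  `⋀⁴ ℂ⁴_{±i}` among `⋀⁴ Γ_ℂ`, where `(1 + I)^*` has the eigenvalues `(1+i)^m (1-i)^{4-m}`,
  `m = 0, …, 4`), also as identities of forms (`Omega_compContinuousLinearMap_J/_S`);
* `Weil.Omega_basis : Ω(e₀, e₁, e₂, e₃) = 1`, hence `Weil.Omega_ne_zero`.

Everything is elementary multilinear algebra (Mathlib's `ContinuousMultilinearMap.mkPiAlgebraFin`,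
`alternatization`, `compContinuousLinearMap`); no named fact is introduced. This is the de Rham
side of clause (c) ("a non-zero rational class of type `(2,2)`") of the barrier fact
`Literature.Barriers.HodgeConjecture.Voisin2002_weilTorus_hodgeClassWithoutSubvarieties`
(`Literature/Barriers/HodgeConjecture/KaehlerCoherentSheaves.lean`), whose discharge programme is
recorded in `KaehlerCoherentSheavesProofs.lean`.

## References

* C. Voisin, IMRN 2002 no. 20, 1057–1075 (arXiv:math/0112247), §3 (pp. 5–6), Prop. 3.
  [Voisin2002KaehlerCounterexample]
* S. Zucker, Compositio Math. 34 (1977) 199–209, Appendix B, pp. 207–208. [Zucker1977]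
* B. van Geemen, in LNM 1594 (1994), Thm. 4.11 (Weil: abelian varieties of Weil type).
  [vanGeemen1994HodgeAV]
-/

noncomputable section

open scoped Manifold ContDiff Topology ComplexConjugate

universe u

namespace Literature.Geometry.Kaehler

open Literature.NumberTheory.Transcendental

namespace Weil

/-! ### The operator `J = diag(i, i, -i, -i)` and the isogeny `S = 1 + J` -/

/-- The eigenvalue pattern `(i, i, -i, -i)` of Voisin's `I` (Zucker's `J`) on `V = ℂ⁴ = ℂ²_i ⊕ ℂ²_{-i}`.
[cite: Voisin2002KaehlerCounterexample, §3 p. 5] -/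
def jsign : Fin 4 → ℂ := ![Complex.I, Complex.I, -Complex.I, -Complex.I]

/-- `jsign 0 = i`. [folklore] -/
@[simp] theorem jsign_zero : jsign 0 = Complex.I := rfl

/-- `jsign 1 = i`. [folklore] -/
@[simp] theorem jsign_one : jsign 1 = Complex.I := rfl

/-- `jsign 2 = -i`. [folklore] -/
@[simp] theorem jsign_two : jsign 2 = -Complex.I := rfl

/-- `jsign 3 = -i`. [folklore] -/
@[simp] theorem jsign_three : jsign 3 = -Complex.I := rfl

/-- `jsign a² = -1`. [folklore] -/
theorem jsign_mul_self (a : Fin 4) : jsign a * jsign a = -1 := by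
  fin_cases a <;> simp

/-- **The Weil operator** `J(z₀, z₁, z₂, z₃) = (iz₀, iz₁, -iz₂, -iz₃)`: the `ℂ`-linear action of
`I ∈ ℤ[I]` on `V = ℂ⁴` with `dim V_i = dim V_{-i} = 2` (Voisin (2002), §3: `W = W_i ⊕ W_{-i}`,
`dim W_i = dim W_{-i} = 2`; Zucker (1977), App. B p. 207 for `ℂⁿ ⊕ ℂⁿ`).
[cite: Voisin2002KaehlerCounterexample, §3 p. 5] [cite: Zucker1977, Appendix B p. 207] -/
def J : (Fin 4 → ℂ) →L[ℂ] (Fin 4 → ℂ) where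
  toFun u a := jsign a * u a
  map_add' u v := funext fun a ↦ mul_add _ _ _
  map_smul' c u := funext fun a ↦ by
    simp only [Pi.smul_apply, smul_eq_mul, RingHom.id_apply]
    ring
  cont := continuous_pi fun a ↦ continuous_const.mul (continuous_apply a)

/-- `(J u)_a = jsign_a · u_a`. [cite: Voisin2002KaehlerCounterexample, §3 p. 5] -/
@[simp] theorem J_apply (u : Fin 4 → ℂ) (a : Fin 4) : J u a = jsign a * u a := rfl

/-- `J² = -1`. [cite: Voisin2002KaehlerCounterexample, §3 p. 5] -/
theorem J_J (u : Fin 4 → ℂ) : J (J u) = -u := by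
  funext a
  simp only [J_apply, Pi.neg_apply, ← mul_assoc, jsign_mul_self, neg_one_mul]

/-- **The isogeny `S = 1 + J`** (the action of `1 + I ∈ ℤ[I]`), as a `ℂ`-linear map of `ℂ⁴`.
[cite: Voisin2002KaehlerCounterexample, §3 p. 5] -/
def S : (Fin 4 → ℂ) →L[ℂ] (Fin 4 → ℂ) := 1 + J

/-- `S u = u + J u`. [folklore] -/
theorem S_apply' (u : Fin 4 → ℂ) : S u = u + J u := rfl

/-- `(S u)_a = (1 + jsign_a) u_a`. [folklore] -/
@[simp] theorem S_apply (u : Fin 4 → ℂ) (a : Fin 4) : S u a = (1 + jsign a) * u a := by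
  rw [S_apply', Pi.add_apply, J_apply]
  ring

/-! ### The coordinate `1`-forms `dz_a`, `dz̄_a` and the Weil form `Ω = dz₀ ∧ dz₁ ∧ dz̄₂ ∧ dz̄₃` -/

/-- The real-linear coordinate form `dz_a : ℂ⁴ → ℂ`. [folklore] -/
def dz (a : Fin 4) : (Fin 4 → ℂ) →L[ℝ] ℂ :=
  (ContinuousLinearMap.proj (R := ℂ) (φ := fun _ : Fin 4 ↦ ℂ) a).restrictScalars ℝ

/-- `dz_a(u) = u_a`. [folklore] -/
@[simp] theorem dz_apply (a : Fin 4) (u : Fin 4 → ℂ) : dz a u = u a := rfl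

/-- The real-linear conjugate coordinate form `dz̄_a : ℂ⁴ → ℂ`, `u ↦ \overline{u_a}`. [folklore] -/
def dzbar (a : Fin 4) : (Fin 4 → ℂ) →L[ℝ] ℂ :=
  Complex.conjCLE.toContinuousLinearMap.comp (dz a)

/-- `dz̄_a(u) = \overline{u_a}`. [folklore] -/
@[simp] theorem dzbar_apply (a : Fin 4) (u : Fin 4 → ℂ) : dzbar a u = conj (u a) := rfl

/-- The multilinear form `dz₀ ⊗ dz₁ ⊗ dz̄₂ ⊗ dz̄₃`, `(v₀, v₁, v₂, v₃) ↦ z₀(v₀) z₁(v₁) \overline{z₂(v₂)}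
\overline{z₃(v₃)}`, whose alternation is the Weil form. [cite: Zucker1977, Appendix B p. 208] -/
def OmegaAux : ContinuousMultilinearMap ℝ (fun _ : Fin 4 ↦ (Fin 4 → ℂ)) ℂ :=
  (ContinuousMultilinearMap.mkPiAlgebraFin ℝ 4 ℂ).compContinuousLinearMap fun i ↦
    ![dz 0, dz 1, dzbar 2, dzbar 3] i

/-- `OmegaAux (v₀, v₁, v₂, v₃) = v₀₀ v₁₁ \overline{v₂₂} \overline{v₃₃}`.
[cite: Zucker1977, Appendix B p. 208] -/
theorem OmegaAux_apply (v : Fin 4 → (Fin 4 → ℂ)) :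
    OmegaAux v = v 0 0 * v 1 1 * conj (v 2 2) * conj (v 3 3) := by
  simp [OmegaAux, ContinuousMultilinearMap.mkPiAlgebraFin_apply]
  ring

/-- **The Weil form** `Ω = dz₀ ∧ dz₁ ∧ dz̄₂ ∧ dz̄₃`, the alternation of `OmegaAux`: a continuous
alternating real `4`-form on `ℂ⁴` with complex values, generating (as an invariant form on any
torus `ℂ⁴/Γ` of Weil type) the line `⋀⁴(ℂ⁴_i)^* = ⋀² W_i^* ⊗ ⋀² W̄_{-i}^*` of Voisin's proof.
[cite: Voisin2002KaehlerCounterexample, §3 pp. 5–6] [cite: Zucker1977, Appendix B p. 208] -/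
def Omega : (Fin 4 → ℂ) [⋀^Fin 4]→L[ℝ] ℂ :=
  ContinuousMultilinearMap.alternatization OmegaAux

/-! ### Characters: how `Ω` transforms under diagonal operators -/

/-- Transfer of a multiplicative transformation law from `OmegaAux` to its alternation `Ω`.
[folklore] -/
theorem Omega_apply_of_OmegaAux {L : (Fin 4 → ℂ) → (Fin 4 → ℂ)} {c : ℂ}
    (h : ∀ v : Fin 4 → (Fin 4 → ℂ), OmegaAux (fun i ↦ L (v i)) = c * OmegaAux v)
    (v : Fin 4 → (Fin 4 → ℂ)) : Omega (fun i ↦ L (v i)) = c * Omega v := by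
  simp only [Omega, ContinuousMultilinearMap.alternatization_apply_apply]
  rw [Finset.mul_sum]
  refine Finset.sum_congr rfl fun σ _ ↦ ?_
  have hσ := h (v ∘ σ)
  simp only [Function.comp_def] at hσ
  simp only [Units.smul_def, zsmul_eq_mul, Function.comp_def]
  rw [hσ]
  ring

/-- `OmegaAux` under a complex homothety `v ↦ c v`: the factor `(c c̄)²`. [folklore] -/
theorem OmegaAux_smul (c : ℂ) (v : Fin 4 → (Fin 4 → ℂ)) :
    OmegaAux (fun i ↦ c • v i) = (c * conj c) ^ 2 * OmegaAux v := by
  rw [OmegaAux_apply, OmegaAux_apply]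
  simp only [Pi.smul_apply, smul_eq_mul, map_mul]
  ring

/-- `OmegaAux` is `J`-invariant: `i · i · \overline{(-i)} · \overline{(-i)} = i⁴ = 1`.
[cite: Zucker1977, Appendix B p. 208] -/
theorem OmegaAux_J (v : Fin 4 → (Fin 4 → ℂ)) :
    OmegaAux (fun i ↦ J (v i)) = 1 * OmegaAux v := by
  rw [OmegaAux_apply, OmegaAux_apply]
  simp only [J_apply, jsign_zero, jsign_one, jsign_two, jsign_three, map_mul, map_neg,
    Complex.conj_I, neg_neg]
  linear_combination (v 0 0 * v 1 1 * conj (v 2 2) * conj (v 3 3)) * Complex.I_pow_four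

/-- `(1 + i)⁴ = -4`. [folklore] -/
theorem one_add_I_pow_four : (1 + Complex.I) ^ 4 = -4 := by
  linear_combination (Complex.I ^ 2 + 4 * Complex.I + 5) * Complex.I_sq

/-- `OmegaAux` is a `-4`-eigenvector of `S = 1 + J`: `(1+i)(1+i)\overline{(1-i)}\,\overline{(1-i)}
= (1+i)⁴ = -4`. [cite: Voisin2002KaehlerCounterexample, §3 pp. 5–6] -/
theorem OmegaAux_S (v : Fin 4 → (Fin 4 → ℂ)) :
    OmegaAux (fun i ↦ S (v i)) = -4 * OmegaAux v := by
  rw [OmegaAux_apply, OmegaAux_apply]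
  simp only [S_apply, jsign_zero, jsign_one, jsign_two, jsign_three, map_mul, map_sub, map_one,
    Complex.conj_I, sub_neg_eq_add, ← sub_eq_add_neg]
  linear_combination (v 0 0 * v 1 1 * conj (v 2 2) * conj (v 3 3)) * one_add_I_pow_four

/-- **`J^*Ω = Ω`** (Zucker: `J^*ω = i^{2n} ω`, here `n = 2`). [cite: Zucker1977, Appendix B p. 208] -/
theorem Omega_J (v : Fin 4 → (Fin 4 → ℂ)) : Omega (fun i ↦ J (v i)) = Omega v := by
  rw [Omega_apply_of_OmegaAux OmegaAux_J v, one_mul]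

/-- **`(1 + J)^*Ω = -4 Ω`**: the Weil form is a `-4`-eigenvector of the isogeny `1 + I` acting on
invariant `4`-forms. [cite: Voisin2002KaehlerCounterexample, §3 pp. 5–6] -/
theorem Omega_S (v : Fin 4 → (Fin 4 → ℂ)) : Omega (fun i ↦ S (v i)) = -4 * Omega v :=
  Omega_apply_of_OmegaAux OmegaAux_S v

/-- `Ω` is invariant under the unit complex homotheties `v ↦ e^{iθ} v`.
[cite: Voisin2002KaehlerCounterexample, §3 pp. 5–6] -/
theorem Omega_smul_exp (θ : ℝ) (v : Fin 4 → (Fin 4 → ℂ)) :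
    Omega (fun i ↦ Complex.exp (θ * Complex.I) • v i) = Omega v := by
  have hc : Complex.exp (θ * Complex.I) * conj (Complex.exp (θ * Complex.I)) = 1 := by
    rw [← Complex.exp_conj, map_mul, Complex.conj_ofReal, Complex.conj_I, ← Complex.exp_add]
    ring_nf
    exact Complex.exp_zero
  have h := Omega_apply_of_OmegaAux (OmegaAux_smul (Complex.exp (θ * Complex.I))) v
  rw [hc] at h
  simpa using h

/-- `J^*Ω = Ω` as an identity of forms. [cite: Zucker1977, Appendix B p. 208] -/
theorem Omega_compContinuousLinearMap_J :
    Omega.compContinuousLinearMap (J.restrictScalars ℝ) = Omega := by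
  ext v
  rw [ContinuousAlternatingMap.compContinuousLinearMap_apply]
  exact Omega_J v

/-- `(1 + J)^*Ω = -4 Ω` as an identity of forms. [cite: Voisin2002KaehlerCounterexample, §3 pp. 5–6] -/
theorem Omega_compContinuousLinearMap_S :
    Omega.compContinuousLinearMap (S.restrictScalars ℝ) = (-4 : ℂ) • Omega := by
  ext v
  rw [ContinuousAlternatingMap.compContinuousLinearMap_apply, ContinuousAlternatingMap.smul_apply,
    smul_eq_mul]
  exact Omega_S v

/-! ### `Ω` is of type `(2, 2)` -/

/-- **The Weil form is of type `(2, 2)`**: `Ω(e^{iθ}v₀, …, e^{iθ}v₃) = e^{i(2-2)θ} Ω(v₀, …, v₃)`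
(`ComplexTorus.IsConstOfType 2 2 Ω`) — the coordinate form of Voisin's "`⋀⁴ ℂ⁴_i = ⋀² W_i ⊗
⋀² W̄_{-i}` is contained in `⋀² W ⊗ ⋀² W̄`, that is in `H^{2,2}(X)`".
[cite: Voisin2002KaehlerCounterexample, §3 pp. 5–6] -/
theorem isConstOfType_two_two_Omega : ComplexTorus.IsConstOfType 2 2 Omega := by
  refine ⟨rfl, fun θ v ↦ ?_⟩
  rw [Omega_smul_exp θ v]
  norm_num

/-- **On every complex torus `X = ℂ⁴/Φ(ℤ^ι)` the class of the invariant form `Ω` lies in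
`H^{2,2}(X)`** (Voisin (2002), §3: `⋀⁴_K Γ_ℚ ⊗ ℂ ∋ Ω` "is made of Hodge classes, that is, is
contained in the subspace `H^{2,2}(X)`"). [cite: Voisin2002KaehlerCounterexample, §3 p. 5] -/
theorem cconstClass_Omega_mem_hodgePQ {ι : Type*} [Fintype ι]
    (Φ : (ι → ℝ) ≃L[ℝ] (Fin 4 → ℂ)) :
    ComplexTorus.cconstClass Φ Omega ∈ hodgePQ (Fin 4 → ℂ) (ComplexTorus Φ) 4 2 2 :=
  ComplexTorus.cconstClass_mem_hodgePQ Φ isConstOfType_two_two_Omega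

/-! ### `Ω ≠ 0` -/

/-- The standard vectors `e_a = (δ_{ab})_b` of `ℂ⁴`. [folklore] -/
theorem OmegaAux_comp_perm_single {σ : Equiv.Perm (Fin 4)} (hσ : σ ≠ 1) :
    OmegaAux (fun i ↦ Pi.single (σ i) (1 : ℂ)) = 0 := by
  have hex : ∃ i, σ i ≠ i := by
    by_contra h
    exact hσ (Equiv.ext fun i ↦ not_not.mp (not_exists.mp h i))
  obtain ⟨i, hi⟩ := hex
  have h0 : (Pi.single (σ i) (1 : ℂ) : Fin 4 → ℂ) i = 0 := by rw [Pi.single_eq_of_ne' hi]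
  have hi4 : i = 0 ∨ i = 1 ∨ i = 2 ∨ i = 3 := by fin_cases i <;> decide
  rw [OmegaAux_apply]
  rcases hi4 with rfl | rfl | rfl | rfl
  · simp [h0]
  · simp [h0]
  · simp [h0]
  · simp [h0]

/-- **`Ω(e₀, e₁, e₂, e₃) = 1`.** [cite: Zucker1977, Appendix B p. 208] -/
theorem Omega_basis : Omega (fun a ↦ Pi.single a (1 : ℂ)) = 1 := by
  simp only [Omega, ContinuousMultilinearMap.alternatization_apply_apply]
  rw [Finset.sum_eq_single (1 : Equiv.Perm (Fin 4))]
  · simp [OmegaAux_apply]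
  · intro σ _ hσ
    have h := OmegaAux_comp_perm_single hσ
    simp only [Function.comp_def]
    rw [h, smul_zero]
  · simp

/-- **`Ω ≠ 0`.** [cite: Voisin2002KaehlerCounterexample, §3 pp. 5–6] -/
theorem Omega_ne_zero : Omega ≠ 0 := fun h ↦ by
  have h1 := Omega_basis
  rw [h] at h1
  simp at h1

/-- On every complex torus `X = ℂ⁴/Φ(ℤ^ι)` the class `[Ω] ∈ H⁴_dR(X; ℂ)` is non-zero (invariant
forms inject into de Rham cohomology, Lange–Birkenhake (1992), Prop. 1.1.20).
[cite: LangeBirkenhake1992, Prop. 1.1.20] -/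
theorem cconstClass_Omega_ne_zero {ι : Type*} [Fintype ι] (Φ : (ι → ℝ) ≃L[ℝ] (Fin 4 → ℂ)) :
    ComplexTorus.cconstClass Φ Omega ≠ 0 := fun h ↦ by
  have h' := congrArg (ComplexTorus.cavgClass Φ) h
  rw [ComplexTorus.cavgClass_cconstClass, map_zero] at h'
  exact Omega_ne_zero h'

end Weil

end Literature.Geometry.Kaehler

end
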